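import Literature.MathematicalPhysics.QuantumFieldTheory.Balaban1983to89.B4Sect5Torus

/-!
# `Balaban1983to89.B9Eq349BlockDecayAlgebra` — T. Bałaban, *Propagators for lattice gauge theories in a background field*, Commun. Math. Phys.
# **99** (1985) 389–434 [Balaban1985BackgroundPropagators] (3.49) p. 399 ∕ Thm 3.11 p. 416 with the random-walk road p. 415, and *Propagators and
# renormalization transformations for lattice gauge theories. I*, Commun. Math. Phys. **95** (1984) 17–40 [Balaban1984PropagatorsI] p. 38: **THE ALGEBRA OF
# BLOCK-DECAYING OPERATORS, IN LETTERS — entries of a PRODUCT through a block family resolving the identity, decay × decay ⟹ decay at any slower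
# rate against ONE displayed lattice letter `S`, and INVERSE STABILITY: if `G₀ = X₀⁻¹` has block decay `(C₀, κ)` and `X − X₀` has block decay `(e, κ)`
# with `q := C₀·e·S² < 1`, then `G = X⁻¹` has block decay `(C₀∕(1 − q), κ′)`** — by the resolvent identity `G₀ − G = G₀(X − X₀)G` and a FINITE-MAX
# bootstrap over the block pairs (no Neumann series, no analyticity, no exponential weights) — route R2′ STEP B8′, road B8″ sub-step S3 (the
# `ε_U`-window around the flat point) of the pub-balaban NE9 chain, instance-ledger row L9, in BLOCK-ENTRY currency; the abstract part (S3a)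

statement-level skeleton of published theorems with citation tags; proofs where landed; nothing here is a claim about the Yang–Mills mass gap

CITATION HEADER (lean-in-tree rule).  Audit cell `pub-balaban`, sub-cell `t4`, BINDER row NE9; filed by NE9 formalisation-swarm LEAF PROVER 01
(`b2b-balaban-t4-ne9-formalise-leaf-01`, gen 84), the lineage of (K1) `B9Eq349BlockMultipliers`, (K3) `B9Eq349ConjugatedDPBlockDecay` and (K4b)
`B9Eq349KWAssembly` (row L9's `hτ` socket `‖P^B_{y₁} ∘ T ∘ P^S_{y₀}‖ ≤ C_τ·e^{−r·d_m(y₀,y₁)}` and its consumer).  Letters: those of (B)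
`B9Eq3101DoubleCommutatorBlockSchur` §3 (block families `p : ι → S →L S`, `Σ_z p_z x = x`, `p_z ∘ p_z = p_z`); a pseudo-metric `δ` on the labels; the
lattice letter `Σ_z e^{−aδ(y,z)} ≤ S` of ne9-leaf-06 g68's `B9Eq349KernelConvolutionDecay` §1 (kernel currency there; here one level up — operators
and block entries).  ROUTE LOCUS: `t4/ROUTES-NE9.md` v13.37 §L1.2 ADDENDUM (ii) (t4-ne9-idea-1 g100), road B8″: S1∕S2 = the flat point (ne9-leaf-06 g68
INTENT-1…6, `hτ(U ≡ 1)` with a κ₁-free rate), **S3 = the window step `U ≡ 1 ⟶ ‖U − 1‖ ≤ ε_U`**, S4 = (K4b) §5's supplier swap.  THIS FILE is S3's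
engine in block currency: the perturbed inverse `c(U) = (X(1) + (X(U) − X(1)))⁻¹` inherits the flat decay of `c(1)` as soon as the perturbation's
block entries are small and decaying — `κ₁` leaves the RATE and enters only the window `q < 1`.  Source READ in the held text
[Balaban1985BackgroundPropagators] (journal page = PDF page + 388): p. 399 (3.49) *«|P(x, x′)|, |(DP)_μ(x, x′)|, … ≤ O(1)[…]e^{−δ₀d(y,y′)} for x ∈ Δ(y),
x′ ∈ Δ(y′)»*; p. 415 *«we will prove the above theorems by constructing generalized random walk expansions»*; p. 416 Thm 3.11; [Balaban1984PropagatorsI]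
p. 38 *«P = G′Q′*(Q′G′²Q′*)⁻¹Q′G′»*.  Print's road is the random-walk expansion of the perturbed inverse; §3 is its operator-algebra shadow (the walk
summed once and for all by a fixed-point bound on a finite maximum).  NOTHING of print's estimates, rates or constants is asserted.

WHAT IS PROVED (sorry-free; proof lane — no `def`; [folklore] finite sums, the triangle inequality, one resolvent identity).
* §1 `comp_block_eq_sum`, **`norm_block_comp_le_sum`** (`‖q(A∘B)p‖ ≤ Σ_z ‖qAr_z‖·‖r_zBp‖` through a middle family `r` resolving the identity).
* §2 `exp_mul_exp_le_of_triangle`, **`sum_exp_slow_fast_le`** (a SLOW leg followed by a FAST leg costs the letter `S` of the gap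
  `κ − κ′` and no rate), **`norm_block_comp_le_of_decay`** ∕ `…'` (`(C_A, κ)·(C_B, κ′) ⟹ (C_A·C_B·S, κ′)`), `norm_block_comp_le_of_decay_same`,
  **`norm_block_comp3_le_of_decay`** (`(C_A·C_c·C_B·S², κ′)`), `decay_of_local` (entries vanishing beyond label distance `ρ` and `≤ e₀` within ⟹
  `(e₀e^{κρ}, κ)` for every `κ ≥ 0`), `decay_mono_rate`, `letter_nonneg`.
* §3 **INVERSE STABILITY** `norm_block_inverse_le_of_decay` (with `resolvent_identity(_apply)` and the bootstrap inequality `block_inverse_bootstrap`):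
  `G₀(X₀v) = v`, `X(Gv) = v`, `X = X₀ + E`; `G₀` with `(C₀, κ)`, `E` with `(e, κ)`, `q = C₀·e·S² < 1` ⟹ `‖r_{y₁} ∘ G ∘ r_{y₀}‖ ≤ (C₀∕(1 − q))·e^{−κ′δ(y₀,y₁)}`.
* §4 THE LATTICE LETTERS (`δ := tdist m` on `TSite d m`, `S := latticeConst d (κ − κ′)` by `B4Sect5Torus.torusSum_le`, VOLUME-FREE):
  **`norm_block_comp_le_of_decay_torus`**, **`norm_block_comp3_le_of_decay_torus`**, **`norm_block_inverse_le_of_decay_torus`**.  §5 non-vacuity.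
HONEST SCOPE.  Abstract bookkeeping; no lattice operator of [B9] is touched, no rate or window is evaluated; the rate LOSS `κ → κ′ < κ` and the
square `S²` are this road's price; the instance (which `X`, which `E`, which `e ∝ ε_U`) is the sequel's.  ONE engine of ONE sub-step (S3) of a route
step, NOT NE9 (cell pub-balaban: NE9 NOT PRINTED ∕ NOT PROVED; «NE9 ⇐ the named binders»; row WALLED ON A MODEL (O-NE9-1; #5 UNRULED); spine
PROVED 0∕9; rung (B)+1 on a finite T⁴ — NOT infinite volume, NOT mass gap, NOT Clay; HONEST DEPENDENCY: continuum YM on T⁴ ⇐ BetaPertH ∧ nine spine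
estimates (0/9 proved); BetaPertH ⇐ (D1) ∧ (D4) ∧ CAP+tail; G-an2-4 gates asym, D1 and NE2/3/4).  NEW file importing `B4Sect5Torus` only; nothing
modified.  Net new unproved facts: 0.
-/

noncomputable section

set_option autoImplicit false

namespace Literature.MathematicalPhysics.QuantumFieldTheory.Balaban1983to89.B9Eq349BlockDecayAlgebra

open ContinuousLinearMap
open scoped BigOperators
open B4Sect5Torus (TSite tdist tdist_nonneg tdist_triangle tdist_symm torusSum_le)
open B4Sect5Proof (latticeConst latticeConst_nonneg)

variable {𝕜 : Type*} [NontriviallyNormedField 𝕜]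
  {S V V' E : Type*} [NormedAddCommGroup S] [NormedSpace 𝕜 S] [NormedAddCommGroup V] [NormedSpace 𝕜 V]
  [NormedAddCommGroup V'] [NormedSpace 𝕜 V'] [NormedAddCommGroup E] [NormedSpace 𝕜 E]
  {ι : Type*} [Fintype ι]

/-! ## §1 Entries of a product through a middle block family -/

section Product

/-- a middle family `r_z` resolving the identity of `V` by idempotents splits a product: `q ∘ (A ∘ B) ∘ p = Σ_z (q ∘ A ∘ r_z) ∘ (r_z ∘ B ∘ p)`. [folklore]
[cite: Balaban1985BackgroundPropagators, (3.49) p.399, p.415 «random walk expansions»; Balaban1984PropagatorsI, p.38] -/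
theorem comp_block_eq_sum (r : ι → V →L[𝕜] V) (hsum : ∀ v, ∑ z, r z v = v) (hidem : ∀ z, r z ∘L r z = r z)
    (A : V →L[𝕜] E) (B : S →L[𝕜] V) (q : E →L[𝕜] E) (p : S →L[𝕜] S) :
    q ∘L (A ∘L B) ∘L p = ∑ z, (q ∘L A ∘L r z) ∘L (r z ∘L B ∘L p) := by
  ext x
  have hz : ∀ z, r z (r z (B (p x))) = r z (B (p x)) := fun z => by
    have := congrArg (fun f : V →L[𝕜] V => f (B (p x))) (hidem z)
    simpa only [comp_apply] using this
  simp only [comp_apply, _root_.sum_apply, hz]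
  rw [← map_sum, ← map_sum, hsum]

/-- **ENTRIES OF A PRODUCT**: `‖q ∘ (A ∘ B) ∘ p‖ ≤ Σ_z ‖q ∘ A ∘ r_z‖·‖r_z ∘ B ∘ p‖`. [folklore]
[cite: Balaban1985BackgroundPropagators, (3.49) p.399, p.415; Balaban1984PropagatorsI, p.38] -/
theorem norm_block_comp_le_sum (r : ι → V →L[𝕜] V) (hsum : ∀ v, ∑ z, r z v = v) (hidem : ∀ z, r z ∘L r z = r z)
    (A : V →L[𝕜] E) (B : S →L[𝕜] V) (q : E →L[𝕜] E) (p : S →L[𝕜] S) :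
    ‖q ∘L (A ∘L B) ∘L p‖ ≤ ∑ z, ‖q ∘L A ∘L r z‖ * ‖r z ∘L B ∘L p‖ := by
  rw [comp_block_eq_sum r hsum hidem A B q p]
  exact (norm_sum_le _ _).trans (Finset.sum_le_sum fun z _ => opNorm_comp_le _ _)

end Product

/-! ## §2 Decay × decay ⟹ decay at any slower rate, against one lattice letter -/

section Decay

variable {δ : ι → ι → ℝ} (hδ0 : ∀ y z, 0 ≤ δ y z) (hδt : ∀ x y z, δ x z ≤ δ x y + δ y z)

omit [Fintype ι] in
include hδt in
/-- termwise: `e^{−κ′δ(u,z)}·e^{−κδ(z,v)} ≤ e^{−κ′δ(u,v)}·e^{−(κ−κ′)δ(z,v)}` for `0 ≤ κ′` (the triangle inequality in the exponent). [folklore]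
[cite: Balaban1985BackgroundPropagators, p.415 «random walk expansions»] -/
theorem exp_mul_exp_le_of_triangle {κ κ' : ℝ} (hκ' : 0 ≤ κ') (u z v : ι) :
    Real.exp (-(κ' * δ u z)) * Real.exp (-(κ * δ z v)) ≤ Real.exp (-(κ' * δ u v)) * Real.exp (-((κ - κ') * δ z v)) := by
  rw [← Real.exp_add, ← Real.exp_add]
  apply Real.exp_le_exp.mpr
  have h2 : κ' * δ u v ≤ κ' * (δ u z + δ z v) := mul_le_mul_of_nonneg_left (hδt u z v) hκ'
  nlinarith

include hδt in
/-- **A SLOW LEG FOLLOWED BY A FAST LEG**: `Σ_z e^{−κ′δ(u,z)}·e^{−κδ(z,v)} ≤ S·e^{−κ′δ(u,v)}` whenever `Σ_z e^{−(κ−κ′)δ(v,z)} ≤ S` (symmetric `δ`) —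
the rate `κ′` survives, the gap `κ − κ′` is paid once in the letter `S`. [folklore]
[cite: Balaban1985BackgroundPropagators, p.415 «random walk expansions»; Balaban1984PropagatorsI, p.38] -/
theorem sum_exp_slow_fast_le (hδs : ∀ y z, δ y z = δ z y) {κ κ' Sc : ℝ} (hκ' : 0 ≤ κ')
    (hS : ∀ y, ∑ z, Real.exp (-((κ - κ') * δ y z)) ≤ Sc) (u v : ι) :
    ∑ z, Real.exp (-(κ' * δ u z)) * Real.exp (-(κ * δ z v)) ≤ Sc * Real.exp (-(κ' * δ u v)) := by
  calc ∑ z, Real.exp (-(κ' * δ u z)) * Real.exp (-(κ * δ z v))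
      ≤ ∑ z, Real.exp (-(κ' * δ u v)) * Real.exp (-((κ - κ') * δ z v)) :=
        Finset.sum_le_sum fun z _ => exp_mul_exp_le_of_triangle hδt hκ' u z v
    _ = Real.exp (-(κ' * δ u v)) * ∑ z, Real.exp (-((κ - κ') * δ v z)) := by
        rw [Finset.mul_sum]; exact Finset.sum_congr rfl fun z _ => by rw [hδs z v]
    _ ≤ Real.exp (-(κ' * δ u v)) * Sc := mul_le_mul_of_nonneg_left (hS v) (Real.exp_pos _).le
    _ = Sc * Real.exp (-(κ' * δ u v)) := mul_comm _ _

/-- the lattice letter is nonnegative as soon as the label set is inhabited (by `y`). [folklore]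
[cite: Balaban1985BackgroundPropagators, p.415] -/
theorem letter_nonneg {a Sc : ℝ} (hS : ∀ y, ∑ z, Real.exp (-(a * δ y z)) ≤ Sc) (y : ι) : 0 ≤ Sc :=
  (Finset.sum_nonneg fun _ _ => (Real.exp_pos _).le).trans (hS y)

omit [Fintype ι] in
/-- rate bookkeeping: decay at rate `κ` implies decay at every rate `κ′ ≤ κ` with the same constant (`0 ≤ C`). [folklore]
[cite: Balaban1985BackgroundPropagators, (3.49) p.399] -/
theorem decay_mono_rate {C κ κ' t x : ℝ} (hC : 0 ≤ C) (hκκ : κ' ≤ κ) (ht : 0 ≤ t) (hx : x ≤ C * Real.exp (-(κ * t))) :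
    x ≤ C * Real.exp (-(κ' * t)) :=
  hx.trans (mul_le_mul_of_nonneg_left (Real.exp_le_exp.mpr (by nlinarith)) hC)

include hδt in
/-- **DECAY × DECAY ⟹ DECAY**: `B : S → V` with entries `‖r_z ∘ B ∘ p_{y₀}‖ ≤ C_B·e^{−κ′δ(y₀,z)}` (slow) and `A : V → E` with `‖q_{y₁} ∘ A ∘ r_z‖ ≤ C_A·e^{−κδ(z,y₁)}`
(fast) give `‖q_{y₁} ∘ (A ∘ B) ∘ p_{y₀}‖ ≤ C_A·C_B·S·e^{−κ′δ(y₀,y₁)}` with the letter `Σ_z e^{−(κ−κ′)δ(y,z)} ≤ S` of the gap. [folklore]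
[cite: Balaban1985BackgroundPropagators, (3.49) p.399, p.415; Balaban1984PropagatorsI, p.38] -/
theorem norm_block_comp_le_of_decay (hδs : ∀ y z, δ y z = δ z y) (r : ι → V →L[𝕜] V) (hsum : ∀ v, ∑ z, r z v = v)
    (hidem : ∀ z, r z ∘L r z = r z) (A : V →L[𝕜] E) (B : S →L[𝕜] V) (q : ι → E →L[𝕜] E) (p : ι → S →L[𝕜] S)
    {CA CB κ κ' Sc : ℝ} (hCA : 0 ≤ CA) (hCB : 0 ≤ CB) (hκ' : 0 ≤ κ')
    (hA : ∀ z y₁, ‖q y₁ ∘L A ∘L r z‖ ≤ CA * Real.exp (-(κ * δ z y₁)))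
    (hB : ∀ y₀ z, ‖r z ∘L B ∘L p y₀‖ ≤ CB * Real.exp (-(κ' * δ y₀ z)))
    (hS : ∀ y, ∑ z, Real.exp (-((κ - κ') * δ y z)) ≤ Sc) (y₀ y₁ : ι) :
    ‖q y₁ ∘L (A ∘L B) ∘L p y₀‖ ≤ CA * CB * Sc * Real.exp (-(κ' * δ y₀ y₁)) := by
  refine (norm_block_comp_le_sum r hsum hidem A B (q y₁) (p y₀)).trans ?_
  calc ∑ z, ‖q y₁ ∘L A ∘L r z‖ * ‖r z ∘L B ∘L p y₀‖
      ≤ ∑ z, (CA * Real.exp (-(κ * δ z y₁))) * (CB * Real.exp (-(κ' * δ y₀ z))) :=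
        Finset.sum_le_sum fun z _ => mul_le_mul (hA z y₁) (hB y₀ z) (norm_nonneg _) (mul_nonneg hCA (Real.exp_pos _).le)
    _ = CA * CB * ∑ z, Real.exp (-(κ' * δ y₀ z)) * Real.exp (-(κ * δ z y₁)) := by
        rw [Finset.mul_sum]; exact Finset.sum_congr rfl fun z _ => by ring
    _ ≤ CA * CB * (Sc * Real.exp (-(κ' * δ y₀ y₁))) :=
        mul_le_mul_of_nonneg_left (sum_exp_slow_fast_le hδt hδs hκ' hS y₀ y₁) (mul_nonneg hCA hCB)
    _ = CA * CB * Sc * Real.exp (-(κ' * δ y₀ y₁)) := by ring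

include hδt in
/-- the mirror: `B` fast (`κ`), `A` slow (`κ′`) ⟹ `A ∘ B` with `(C_A·C_B·S, κ′)`. [folklore]
[cite: Balaban1985BackgroundPropagators, (3.49) p.399, p.415; Balaban1984PropagatorsI, p.38] -/
theorem norm_block_comp_le_of_decay' (hδs : ∀ y z, δ y z = δ z y) (r : ι → V →L[𝕜] V) (hsum : ∀ v, ∑ z, r z v = v)
    (hidem : ∀ z, r z ∘L r z = r z) (A : V →L[𝕜] E) (B : S →L[𝕜] V) (q : ι → E →L[𝕜] E) (p : ι → S →L[𝕜] S)
    {CA CB κ κ' Sc : ℝ} (hCA : 0 ≤ CA) (hCB : 0 ≤ CB) (hκ' : 0 ≤ κ')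
    (hA : ∀ z y₁, ‖q y₁ ∘L A ∘L r z‖ ≤ CA * Real.exp (-(κ' * δ z y₁)))
    (hB : ∀ y₀ z, ‖r z ∘L B ∘L p y₀‖ ≤ CB * Real.exp (-(κ * δ y₀ z)))
    (hS : ∀ y, ∑ z, Real.exp (-((κ - κ') * δ y z)) ≤ Sc) (y₀ y₁ : ι) :
    ‖q y₁ ∘L (A ∘L B) ∘L p y₀‖ ≤ CA * CB * Sc * Real.exp (-(κ' * δ y₀ y₁)) := by
  refine (norm_block_comp_le_sum r hsum hidem A B (q y₁) (p y₀)).trans ?_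
  calc ∑ z, ‖q y₁ ∘L A ∘L r z‖ * ‖r z ∘L B ∘L p y₀‖
      ≤ ∑ z, (CA * Real.exp (-(κ' * δ z y₁))) * (CB * Real.exp (-(κ * δ y₀ z))) :=
        Finset.sum_le_sum fun z _ => mul_le_mul (hA z y₁) (hB y₀ z) (norm_nonneg _) (mul_nonneg hCA (Real.exp_pos _).le)
    _ = CA * CB * ∑ z, Real.exp (-(κ' * δ y₁ z)) * Real.exp (-(κ * δ z y₀)) := by
        rw [Finset.mul_sum]; exact Finset.sum_congr rfl fun z _ => by rw [hδs z y₁, hδs y₀ z]; ring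
    _ ≤ CA * CB * (Sc * Real.exp (-(κ' * δ y₁ y₀))) :=
        mul_le_mul_of_nonneg_left (sum_exp_slow_fast_le hδt hδs hκ' hS y₁ y₀) (mul_nonneg hCA hCB)
    _ = CA * CB * Sc * Real.exp (-(κ' * δ y₀ y₁)) := by rw [hδs y₁ y₀]; ring

include hδ0 hδt in
/-- both factors at the fast rate `κ` ⟹ `A ∘ B` with `(C_A·C_B·S, κ′)` for every `0 ≤ κ′ ≤ κ`. [folklore]
[cite: Balaban1985BackgroundPropagators, (3.49) p.399, p.415; Balaban1984PropagatorsI, p.38] -/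
theorem norm_block_comp_le_of_decay_same (hδs : ∀ y z, δ y z = δ z y) (r : ι → V →L[𝕜] V) (hsum : ∀ v, ∑ z, r z v = v)
    (hidem : ∀ z, r z ∘L r z = r z) (A : V →L[𝕜] E) (B : S →L[𝕜] V) (q : ι → E →L[𝕜] E) (p : ι → S →L[𝕜] S)
    {CA CB κ κ' Sc : ℝ} (hCA : 0 ≤ CA) (hCB : 0 ≤ CB) (hκ' : 0 ≤ κ') (hκκ : κ' ≤ κ)
    (hA : ∀ z y₁, ‖q y₁ ∘L A ∘L r z‖ ≤ CA * Real.exp (-(κ * δ z y₁)))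
    (hB : ∀ y₀ z, ‖r z ∘L B ∘L p y₀‖ ≤ CB * Real.exp (-(κ * δ y₀ z)))
    (hS : ∀ y, ∑ z, Real.exp (-((κ - κ') * δ y z)) ≤ Sc) (y₀ y₁ : ι) :
    ‖q y₁ ∘L (A ∘L B) ∘L p y₀‖ ≤ CA * CB * Sc * Real.exp (-(κ' * δ y₀ y₁)) :=
  norm_block_comp_le_of_decay hδt hδs r hsum hidem A B q p hCA hCB hκ' hA
    (fun y₀ z => decay_mono_rate hCB hκκ (hδ0 y₀ z) (hB y₀ z)) hS y₀ y₁

include hδ0 hδt in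
/-- **THREE DECAYING FACTORS**: `B : S → V`, `c : V → V′`, `A : V′ → E` all with rate `κ` and constants `C_B, C_c, C_A` ⟹ `A ∘ c ∘ B` with `(C_A·C_c·C_B·S², κ′)`
(the shape in which `T = (D G′Q̃′†)·(Q̃′G′²Q̃′†)⁻¹·(Q̃′G′)` is assembled from its three factors). [folklore]
[cite: Balaban1984PropagatorsI, p.38 «P = G′Q′*(Q′G′²Q′*)⁻¹Q′G′»; Balaban1985BackgroundPropagators, (3.49) p.399, (3.25) p.394] -/
theorem norm_block_comp3_le_of_decay (hδs : ∀ y z, δ y z = δ z y)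
    (r : ι → V →L[𝕜] V) (hsum : ∀ v, ∑ z, r z v = v) (hidem : ∀ z, r z ∘L r z = r z)
    (r' : ι → V' →L[𝕜] V') (hsum' : ∀ v, ∑ z, r' z v = v) (hidem' : ∀ z, r' z ∘L r' z = r' z)
    (A : V' →L[𝕜] E) (c : V →L[𝕜] V') (B : S →L[𝕜] V) (q : ι → E →L[𝕜] E) (p : ι → S →L[𝕜] S)
    {CA Cc CB κ κ' Sc : ℝ} (hCA : 0 ≤ CA) (hCc : 0 ≤ Cc) (hCB : 0 ≤ CB) (hκ' : 0 ≤ κ') (hκκ : κ' ≤ κ)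
    (hA : ∀ z y₁, ‖q y₁ ∘L A ∘L r' z‖ ≤ CA * Real.exp (-(κ * δ z y₁)))
    (hc : ∀ z z', ‖r' z' ∘L c ∘L r z‖ ≤ Cc * Real.exp (-(κ * δ z z')))
    (hB : ∀ y₀ z, ‖r z ∘L B ∘L p y₀‖ ≤ CB * Real.exp (-(κ * δ y₀ z)))
    (hS : ∀ y, ∑ z, Real.exp (-((κ - κ') * δ y z)) ≤ Sc) (y₀ y₁ : ι) :
    ‖q y₁ ∘L (A ∘L c ∘L B) ∘L p y₀‖ ≤ CA * Cc * CB * Sc ^ 2 * Real.exp (-(κ' * δ y₀ y₁)) := by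
  have hSc : 0 ≤ Sc := letter_nonneg hS y₀
  -- the inner product `c ∘ B` decays with `(C_c·C_B·S, κ′)`
  have hcB : ∀ y₀ z', ‖r' z' ∘L (c ∘L B) ∘L p y₀‖ ≤ Cc * CB * Sc * Real.exp (-(κ' * δ y₀ z')) := fun y₀ z' =>
    norm_block_comp_le_of_decay_same hδ0 hδt hδs r hsum hidem c B r' p hCc hCB hκ' hκκ hc hB hS y₀ z'
  -- then `A` (fast) after `c ∘ B` (slow)
  have h := norm_block_comp_le_of_decay hδt hδs r' hsum' hidem' A (c ∘L B) q p hCA (by positivity) hκ' hA hcB hS y₀ y₁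
  calc ‖q y₁ ∘L (A ∘L c ∘L B) ∘L p y₀‖ = ‖q y₁ ∘L (A ∘L (c ∘L B)) ∘L p y₀‖ := rfl
    _ ≤ CA * (Cc * CB * Sc) * Sc * Real.exp (-(κ' * δ y₀ y₁)) := h
    _ = CA * Cc * CB * Sc ^ 2 * Real.exp (-(κ' * δ y₀ y₁)) := by ring

omit [Fintype ι] in
/-- **A LOCAL OPERATOR DECAYS AT EVERY RATE**: entries vanishing beyond label distance `ρ` and bounded by `e₀` within give `(e₀·e^{κρ}, κ)` for every
`κ ≥ 0` (the shape of `D_U − D_1`, `Q̃′(U) − Q̃′(1)`: range one block, size `∝ ε_U`). [folklore]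
[cite: Balaban1985BackgroundPropagators, (3.3) p.390, (3.19) p.393, (3.49) p.399] -/
theorem decay_of_local {X Y : Type*} [NormedAddCommGroup X] [NormedSpace 𝕜 X] [NormedAddCommGroup Y] [NormedSpace 𝕜 Y]
    (T : X →L[𝕜] Y) (q : ι → Y →L[𝕜] Y) (p : ι → X →L[𝕜] X) {ρ e₀ κ : ℝ} (he₀ : 0 ≤ e₀) (hκ : 0 ≤ κ)
    (hfar : ∀ y₀ y₁, ρ < δ y₀ y₁ → q y₁ ∘L T ∘L p y₀ = 0) (hnear : ∀ y₀ y₁, δ y₀ y₁ ≤ ρ → ‖q y₁ ∘L T ∘L p y₀‖ ≤ e₀) (y₀ y₁ : ι) :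
    ‖q y₁ ∘L T ∘L p y₀‖ ≤ e₀ * Real.exp (κ * ρ) * Real.exp (-(κ * δ y₀ y₁)) := by
  rcases lt_or_ge ρ (δ y₀ y₁) with hlt | hle
  · rw [hfar y₀ y₁ hlt, norm_zero]; positivity
  · refine (hnear y₀ y₁ hle).trans ?_
    rw [mul_assoc, ← Real.exp_add]
    have : (1 : ℝ) ≤ Real.exp (κ * ρ + -(κ * δ y₀ y₁)) := Real.one_le_exp (by nlinarith)
    nlinarith

end Decay

/-! ## §3 Inverse stability under a small decaying perturbation (the finite-max bootstrap) -/

section Inverse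

variable {δ : ι → ι → ℝ} (hδ0 : ∀ y z, 0 ≤ δ y z) (hδt : ∀ x y z, δ x z ≤ δ x y + δ y z)

/-- **THE RESOLVENT IDENTITY** (pointwise): a left inverse `G₀` of `X₀` and a right inverse `G` of `X = X₀ + E` satisfy `G₀v − Gv = G₀(E(Gv))`. [folklore]
[cite: Balaban1985BackgroundPropagators, p.415 «random walk expansions», (3.24)–(3.25) p.394; Balaban1984PropagatorsI, p.38] -/
theorem resolvent_identity_apply (X₀ X E G₀ G : V →L[𝕜] V) (hG₀ : ∀ v, G₀ (X₀ v) = v) (hG : ∀ v, X (G v) = v)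
    (hXE : ∀ v, X v = X₀ v + E v) (v : V) : G₀ v - G v = G₀ (E (G v)) := by
  have h := hXE (G v)
  rw [hG] at h
  have h1 : E (G v) = v - X₀ (G v) := eq_sub_of_add_eq' h.symm
  rw [h1, map_sub, hG₀]

/-- … as operators: `G₀ − G = G₀ ∘ E ∘ G`. [folklore]
[cite: Balaban1985BackgroundPropagators, p.415, (3.24)–(3.25) p.394; Balaban1984PropagatorsI, p.38] -/
theorem resolvent_identity (X₀ X E G₀ G : V →L[𝕜] V) (hG₀ : ∀ v, G₀ (X₀ v) = v) (hG : ∀ v, X (G v) = v)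
    (hXE : ∀ v, X v = X₀ v + E v) : G₀ - G = G₀ ∘L E ∘L G := by
  ext v; simpa only [sub_apply, comp_apply] using resolvent_identity_apply X₀ X E G₀ G hG₀ hG hXE v

include hδ0 hδt in
/-- **THE BOOTSTRAP INEQUALITY**: with one block family `r`, `G₀` decaying with `(C₀, κ)`, `E` with `(e, κ)`, and ANY bound `‖r_{y₁} ∘ G ∘ r_{y₀}‖ ≤
s·e^{−κ′δ(y₀,y₁)}` on the unknown inverse (`0 ≤ s`, `0 ≤ κ′ ≤ κ`), the resolvent identity returns the improved
`‖r_{y₁} ∘ G ∘ r_{y₀}‖ ≤ (C₀ + C₀·e·S²·s)·e^{−κ′δ(y₀,y₁)}`. [folklore]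
[cite: Balaban1985BackgroundPropagators, p.415 «random walk expansions», Thm 3.11 p.416; Balaban1984PropagatorsI, p.38] -/
theorem block_inverse_bootstrap (hδs : ∀ y z, δ y z = δ z y) (r : ι → V →L[𝕜] V) (hsum : ∀ v, ∑ z, r z v = v)
    (hidem : ∀ z, r z ∘L r z = r z) (X₀ X E G₀ G : V →L[𝕜] V) (hG₀ : ∀ v, G₀ (X₀ v) = v) (hG : ∀ v, X (G v) = v)
    (hXE : ∀ v, X v = X₀ v + E v) {C₀ e κ κ' Sc s : ℝ} (hC₀ : 0 ≤ C₀) (he : 0 ≤ e) (hκ' : 0 ≤ κ') (hκκ : κ' ≤ κ) (hs : 0 ≤ s)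
    (hG₀d : ∀ y₀ y₁, ‖r y₁ ∘L G₀ ∘L r y₀‖ ≤ C₀ * Real.exp (-(κ * δ y₀ y₁)))
    (hEd : ∀ y₀ y₁, ‖r y₁ ∘L E ∘L r y₀‖ ≤ e * Real.exp (-(κ * δ y₀ y₁)))
    (hS : ∀ y, ∑ z, Real.exp (-((κ - κ') * δ y z)) ≤ Sc)
    (hGs : ∀ y₀ y₁, ‖r y₁ ∘L G ∘L r y₀‖ ≤ s * Real.exp (-(κ' * δ y₀ y₁))) (y₀ y₁ : ι) :
    ‖r y₁ ∘L G ∘L r y₀‖ ≤ (C₀ + C₀ * e * Sc ^ 2 * s) * Real.exp (-(κ' * δ y₀ y₁)) := by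
  -- `G = G₀ − G₀EG` on the block
  have hsplit : r y₁ ∘L G ∘L r y₀ = r y₁ ∘L G₀ ∘L r y₀ - r y₁ ∘L (G₀ ∘L E ∘L G) ∘L r y₀ := by
    rw [← resolvent_identity X₀ X E G₀ G hG₀ hG hXE]
    ext v; simp only [comp_apply, sub_apply, map_sub]; abel
  -- the triple product decays with `(C₀·e·s·S², κ′)`: `G` slow, then `E` and `G₀` fast
  have h3 : ‖r y₁ ∘L (G₀ ∘L E ∘L G) ∘L r y₀‖ ≤ C₀ * e * s * Sc ^ 2 * Real.exp (-(κ' * δ y₀ y₁)) := by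
    have hSc : 0 ≤ Sc := letter_nonneg hS y₀
    have hEG : ∀ y₀ z, ‖r z ∘L (E ∘L G) ∘L r y₀‖ ≤ e * s * Sc * Real.exp (-(κ' * δ y₀ z)) := fun y₀ z =>
      norm_block_comp_le_of_decay hδt hδs r hsum hidem E G r r he hs hκ' (fun z y₁ => hEd z y₁) hGs hS y₀ z
    have h := norm_block_comp_le_of_decay hδt hδs r hsum hidem G₀ (E ∘L G) r r hC₀ (mul_nonneg (mul_nonneg he hs) hSc) hκ'
      (fun z y₁ => hG₀d z y₁) hEG hS y₀ y₁
    calc ‖r y₁ ∘L (G₀ ∘L E ∘L G) ∘L r y₀‖ = ‖r y₁ ∘L (G₀ ∘L (E ∘L G)) ∘L r y₀‖ := rfl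
      _ ≤ C₀ * (e * s * Sc) * Sc * Real.exp (-(κ' * δ y₀ y₁)) := h
      _ = C₀ * e * s * Sc ^ 2 * Real.exp (-(κ' * δ y₀ y₁)) := by ring
  have h0 : ‖r y₁ ∘L G₀ ∘L r y₀‖ ≤ C₀ * Real.exp (-(κ' * δ y₀ y₁)) := decay_mono_rate hC₀ hκκ (hδ0 y₀ y₁) (hG₀d y₀ y₁)
  rw [hsplit]
  calc ‖r y₁ ∘L G₀ ∘L r y₀ - r y₁ ∘L (G₀ ∘L E ∘L G) ∘L r y₀‖
      ≤ ‖r y₁ ∘L G₀ ∘L r y₀‖ + ‖r y₁ ∘L (G₀ ∘L E ∘L G) ∘L r y₀‖ := norm_sub_le _ _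
    _ ≤ C₀ * Real.exp (-(κ' * δ y₀ y₁)) + C₀ * e * s * Sc ^ 2 * Real.exp (-(κ' * δ y₀ y₁)) := add_le_add h0 h3
    _ = (C₀ + C₀ * e * Sc ^ 2 * s) * Real.exp (-(κ' * δ y₀ y₁)) := by ring

include hδ0 hδt in
/-- **INVERSE STABILITY UNDER A SMALL DECAYING PERTURBATION.**  One space `V`, one block family `r_z` (resolving the identity, idempotent);
`G₀` a left inverse of `X₀` with block decay `‖r_{y₁} ∘ G₀ ∘ r_{y₀}‖ ≤ C₀·e^{−κδ(y₀,y₁)}`; `G` a right inverse of `X = X₀ + E` where the perturbation has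
block decay `‖r_{y₁} ∘ E ∘ r_{y₀}‖ ≤ e·e^{−κδ(y₀,y₁)}`; the lattice letter `Σ_z e^{−(κ−κ′)δ(y,z)} ≤ S` of the gap to a slower rate `0 ≤ κ′ ≤ κ`; and the window
`q := C₀·e·S² < 1`.  THEN `‖r_{y₁} ∘ G ∘ r_{y₀}‖ ≤ (C₀∕(1 − q))·e^{−κ′δ(y₀,y₁)}` for every pair — the perturbed inverse inherits the decay, the smallness
entering only the window.  Proof: the finite maximum `s` of `‖r_{y₁}Gr_{y₀}‖e^{κ′δ(y₀,y₁)}` obeys `s ≤ C₀ + q·s` by `block_inverse_bootstrap`. [folklore]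
(the operator-algebra shadow of print's random-walk expansion for a perturbed inverse)
[cite: Balaban1985BackgroundPropagators, Thm 3.11 p.416 «uniformly bounded from below … decay exponentially», p.415 «random walk expansions», (3.49) p.399;
Balaban1984PropagatorsI, p.38] -/
theorem norm_block_inverse_le_of_decay (hδs : ∀ y z, δ y z = δ z y) (r : ι → V →L[𝕜] V) (hsum : ∀ v, ∑ z, r z v = v)
    (hidem : ∀ z, r z ∘L r z = r z) (X₀ X E G₀ G : V →L[𝕜] V) (hG₀ : ∀ v, G₀ (X₀ v) = v)
    (hG : ∀ v, X (G v) = v) (hXE : ∀ v, X v = X₀ v + E v) {C₀ e κ κ' Sc : ℝ} (hC₀ : 0 ≤ C₀) (he : 0 ≤ e) (hκ' : 0 ≤ κ')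
    (hκκ : κ' ≤ κ)
    (hG₀d : ∀ y₀ y₁, ‖r y₁ ∘L G₀ ∘L r y₀‖ ≤ C₀ * Real.exp (-(κ * δ y₀ y₁)))
    (hEd : ∀ y₀ y₁, ‖r y₁ ∘L E ∘L r y₀‖ ≤ e * Real.exp (-(κ * δ y₀ y₁)))
    (hS : ∀ y, ∑ z, Real.exp (-((κ - κ') * δ y z)) ≤ Sc) (hq : C₀ * e * Sc ^ 2 < 1) (y₀ y₁ : ι) :
    ‖r y₁ ∘L G ∘L r y₀‖ ≤ C₀ / (1 - C₀ * e * Sc ^ 2) * Real.exp (-(κ' * δ y₀ y₁)) := by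
  classical
  -- the weighted entries and their finite maximum
  set g : ι × ι → ℝ := fun yy => ‖r yy.2 ∘L G ∘L r yy.1‖ * Real.exp (κ' * δ yy.1 yy.2) with hg
  have hne : (Finset.univ : Finset (ι × ι)).Nonempty := ⟨(y₀, y₁), Finset.mem_univ _⟩
  set s : ℝ := Finset.univ.sup' hne g with hs_def
  have hg0 : ∀ yy, 0 ≤ g yy := fun yy => mul_nonneg (norm_nonneg _) (Real.exp_pos _).le
  have hle_s : ∀ a b : ι, g (a, b) ≤ s := fun a b => Finset.le_sup' g (Finset.mem_univ (a, b))
  have hs0 : 0 ≤ s := (hg0 (y₀, y₁)).trans (hle_s y₀ y₁)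
  -- the a-priori bound `‖r_b G r_a‖ ≤ s·e^{−κ′δ(a,b)}`
  have hGs : ∀ a b : ι, ‖r b ∘L G ∘L r a‖ ≤ s * Real.exp (-(κ' * δ a b)) := fun a b => by
    have h := hle_s a b
    have hexp : 0 < Real.exp (κ' * δ a b) := Real.exp_pos _
    rw [Real.exp_neg, ← div_eq_mul_inv, le_div_iff₀ hexp]
    exact h
  -- the bootstrap at a maximising pair
  obtain ⟨ab, -, hab⟩ := Finset.exists_mem_eq_sup' hne g
  have hboot := block_inverse_bootstrap hδ0 hδt hδs r hsum hidem X₀ X E G₀ G hG₀ hG hXE hC₀ he hκ' hκκ hs0 hG₀d hEd hS hGs ab.1 ab.2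
  have hs_le : s ≤ C₀ + C₀ * e * Sc ^ 2 * s := by
    have hexp : 0 < Real.exp (κ' * δ ab.1 ab.2) := Real.exp_pos _
    have h1 : s = ‖r ab.2 ∘L G ∘L r ab.1‖ * Real.exp (κ' * δ ab.1 ab.2) := by rw [hs_def, hab]
    have h2 : ‖r ab.2 ∘L G ∘L r ab.1‖ * Real.exp (κ' * δ ab.1 ab.2) ≤
        (C₀ + C₀ * e * Sc ^ 2 * s) * Real.exp (-(κ' * δ ab.1 ab.2)) * Real.exp (κ' * δ ab.1 ab.2) :=
      mul_le_mul_of_nonneg_right hboot hexp.le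
    rw [mul_assoc, ← Real.exp_add, neg_add_cancel, Real.exp_zero, mul_one] at h2
    calc s = ‖r ab.2 ∘L G ∘L r ab.1‖ * Real.exp (κ' * δ ab.1 ab.2) := h1
      _ ≤ C₀ + C₀ * e * Sc ^ 2 * s := h2
  -- solve the bootstrap: `s ≤ C₀ ∕ (1 − q)`
  have hq1 : 0 < 1 - C₀ * e * Sc ^ 2 := sub_pos.mpr hq
  have hs_fin : s ≤ C₀ / (1 - C₀ * e * Sc ^ 2) := by
    rw [le_div_iff₀ hq1]; nlinarith
  exact (hGs y₀ y₁).trans (mul_le_mul_of_nonneg_right hs_fin (Real.exp_pos _).le)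

end Inverse

/-! ## §4 The lattice letters: `δ := tdist m` on the coarse torus, `S := latticeConst d (κ − κ′)` by `torusSum_le` -/

section Lattice

variable {d : ℕ} {m : Fin d → ℕ}

/-- **DECAY × DECAY ON THE COARSE TORUS**: labels `TSite d m`, `δ = tdist m` (symmetric, triangle, `≥ 0` — `B4Sect5Torus`), gap letter
`S = K_d(κ − κ′) = latticeConst d (κ − κ′)` (VOLUME-FREE, `torusSum_le`): `B` slow `(C_B, κ′)`, `A` fast `(C_A, κ)`, `0 ≤ κ′ < κ` ⟹ `A ∘ B` with
`(C_A·C_B·K_d(κ−κ′), κ′)`. [folklore] [cite: Balaban1985BackgroundPropagators, (3.49) p.399, p.415; Balaban1984PropagatorsI, p.38] -/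
theorem norm_block_comp_le_of_decay_torus (hm : ∀ i, 1 ≤ m i) (r : TSite d m → V →L[𝕜] V) (hsum : ∀ v, ∑ z, r z v = v)
    (hidem : ∀ z, r z ∘L r z = r z) (A : V →L[𝕜] E) (B : S →L[𝕜] V) (q : TSite d m → E →L[𝕜] E) (p : TSite d m → S →L[𝕜] S)
    {CA CB κ κ' : ℝ} (hCA : 0 ≤ CA) (hCB : 0 ≤ CB) (hκ' : 0 ≤ κ') (hκκ : κ' < κ)
    (hA : ∀ z y₁, ‖q y₁ ∘L A ∘L r z‖ ≤ CA * Real.exp (-(κ * tdist m z y₁)))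
    (hB : ∀ y₀ z, ‖r z ∘L B ∘L p y₀‖ ≤ CB * Real.exp (-(κ' * tdist m y₀ z))) (y₀ y₁ : TSite d m) :
    ‖q y₁ ∘L (A ∘L B) ∘L p y₀‖ ≤ CA * CB * latticeConst d (κ - κ') * Real.exp (-(κ' * tdist m y₀ y₁)) :=
  norm_block_comp_le_of_decay (tdist_triangle hm) (tdist_symm hm) r hsum hidem A B q p hCA hCB hκ' hA hB
    (fun y => torusSum_le d hm (sub_pos.mpr hκκ) y) y₀ y₁

/-- **THREE DECAYING FACTORS ON THE COARSE TORUS**: `(C_A·C_c·C_B·K_d(κ−κ′)², κ′)`. [folklore]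
[cite: Balaban1984PropagatorsI, p.38 «P = G′Q′*(Q′G′²Q′*)⁻¹Q′G′»; Balaban1985BackgroundPropagators, (3.49) p.399, (3.25) p.394] -/
theorem norm_block_comp3_le_of_decay_torus (hm : ∀ i, 1 ≤ m i) (r : TSite d m → V →L[𝕜] V) (hsum : ∀ v, ∑ z, r z v = v)
    (hidem : ∀ z, r z ∘L r z = r z) (r' : TSite d m → V' →L[𝕜] V') (hsum' : ∀ v, ∑ z, r' z v = v) (hidem' : ∀ z, r' z ∘L r' z = r' z)
    (A : V' →L[𝕜] E) (c : V →L[𝕜] V') (B : S →L[𝕜] V) (q : TSite d m → E →L[𝕜] E) (p : TSite d m → S →L[𝕜] S)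
    {CA Cc CB κ κ' : ℝ} (hCA : 0 ≤ CA) (hCc : 0 ≤ Cc) (hCB : 0 ≤ CB) (hκ' : 0 ≤ κ') (hκκ : κ' < κ)
    (hA : ∀ z y₁, ‖q y₁ ∘L A ∘L r' z‖ ≤ CA * Real.exp (-(κ * tdist m z y₁)))
    (hc : ∀ z z', ‖r' z' ∘L c ∘L r z‖ ≤ Cc * Real.exp (-(κ * tdist m z z')))
    (hB : ∀ y₀ z, ‖r z ∘L B ∘L p y₀‖ ≤ CB * Real.exp (-(κ * tdist m y₀ z))) (y₀ y₁ : TSite d m) :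
    ‖q y₁ ∘L (A ∘L c ∘L B) ∘L p y₀‖ ≤ CA * Cc * CB * latticeConst d (κ - κ') ^ 2 * Real.exp (-(κ' * tdist m y₀ y₁)) :=
  norm_block_comp3_le_of_decay (tdist_nonneg m) (tdist_triangle hm) (tdist_symm hm) r hsum hidem r' hsum' hidem' A c B q p
    hCA hCc hCB hκ' hκκ.le hA hc hB (fun y => torusSum_le d hm (sub_pos.mpr hκκ) y) y₀ y₁

/-- **INVERSE STABILITY ON THE COARSE TORUS**: one family `r_z` on `V` labelled by `TSite d m`; `G₀(X₀v) = v`, `X(Gv) = v`, `X = X₀ + E`; `G₀` with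
`(C₀, κ)`, `E` with `(e, κ)`, `0 ≤ κ′ < κ`, window `q = C₀·e·K_d(κ−κ′)² < 1` ⟹ `‖r_{y₁} ∘ G ∘ r_{y₀}‖ ≤ (C₀∕(1 − q))·e^{−κ′d_m(y₀,y₁)}` — uniform in the
volume `m` (it sits outside every constant). [folklore] [cite: Balaban1985BackgroundPropagators, Thm 3.11 p.416, p.415 «random walk expansions»,
(3.49) p.399; Balaban1984PropagatorsI, p.38] -/
theorem norm_block_inverse_le_of_decay_torus (hm : ∀ i, 1 ≤ m i) (r : TSite d m → V →L[𝕜] V) (hsum : ∀ v, ∑ z, r z v = v)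
    (hidem : ∀ z, r z ∘L r z = r z) (X₀ X E G₀ G : V →L[𝕜] V) (hG₀ : ∀ v, G₀ (X₀ v) = v)
    (hG : ∀ v, X (G v) = v) (hXE : ∀ v, X v = X₀ v + E v) {C₀ e κ κ' : ℝ} (hC₀ : 0 ≤ C₀) (he : 0 ≤ e) (hκ' : 0 ≤ κ')
    (hκκ : κ' < κ)
    (hG₀d : ∀ y₀ y₁, ‖r y₁ ∘L G₀ ∘L r y₀‖ ≤ C₀ * Real.exp (-(κ * tdist m y₀ y₁)))
    (hEd : ∀ y₀ y₁, ‖r y₁ ∘L E ∘L r y₀‖ ≤ e * Real.exp (-(κ * tdist m y₀ y₁)))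
    (hq : C₀ * e * latticeConst d (κ - κ') ^ 2 < 1) (y₀ y₁ : TSite d m) :
    ‖r y₁ ∘L G ∘L r y₀‖ ≤ C₀ / (1 - C₀ * e * latticeConst d (κ - κ') ^ 2) * Real.exp (-(κ' * tdist m y₀ y₁)) :=
  norm_block_inverse_le_of_decay (tdist_nonneg m) (tdist_triangle hm) (tdist_symm hm) r hsum hidem X₀ X E G₀ G hG₀ hG hXE hC₀ he hκ'
    hκκ.le hG₀d hEd (fun y => torusSum_le d hm (sub_pos.mpr hκκ) y) hq y₀ y₁

end Lattice

/-! ## §5 Non-vacuity -/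

/-- §3's letters at one block (`ι = Unit`, `δ = 0`, `r = 1` on `𝕜`), `X₀ = X = G₀ = G = 1`, `E = 0`: decay `(1, 1)` for `G₀`, `(0, 1)` for `E`, letter
`S = 1`, window `q = 0 < 1`, and the conclusion reads `‖1 ∘ 1 ∘ 1‖ ≤ (1∕(1 − 0))·e^{0}`. [folklore] [cite: Balaban1985BackgroundPropagators, (3.49) p.399] -/
example : ‖(1 : 𝕜 →L[𝕜] 𝕜) ∘L (1 : 𝕜 →L[𝕜] 𝕜) ∘L (1 : 𝕜 →L[𝕜] 𝕜)‖ ≤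
    1 / (1 - 1 * 0 * 1 ^ 2) * Real.exp (-((1 / 2 : ℝ) * (fun _ _ : Unit => (0 : ℝ)) () ())) :=
  have h111 : ‖(1 : 𝕜 →L[𝕜] 𝕜) ∘L (1 : 𝕜 →L[𝕜] 𝕜) ∘L (1 : 𝕜 →L[𝕜] 𝕜)‖ ≤ 1 := by
    rw [show (1 : 𝕜 →L[𝕜] 𝕜) ∘L (1 : 𝕜 →L[𝕜] 𝕜) ∘L (1 : 𝕜 →L[𝕜] 𝕜) = ContinuousLinearMap.id 𝕜 𝕜 by ext; simp]
    exact norm_id_le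
  norm_block_inverse_le_of_decay (ι := Unit) (V := 𝕜) (δ := fun _ _ => (0 : ℝ)) (fun _ _ => le_rfl) (fun _ _ _ => by simp)
    (fun _ _ => rfl) (fun _ => (1 : 𝕜 →L[𝕜] 𝕜)) (fun v => by simp) (fun _ => by ext; simp)
    1 1 0 1 1 (fun v => by simp) (fun v => by simp) (fun v => by simp) (C₀ := 1) (e := 0) (κ := 1) (κ' := 1 / 2) (Sc := 1)
    zero_le_one le_rfl (by norm_num) (by norm_num)
    (fun _ _ => by simpa using h111) (fun _ _ => by simp) (fun _ => by simp) (by norm_num) () ()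

end Literature.MathematicalPhysics.QuantumFieldTheory.Balaban1983to89.B9Eq349BlockDecayAlgebra

end
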